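import Mathlib.NumberTheory.PrimeCounting
import Mathlib.Analysis.SpecialFunctions.Log.Basic
import Mathlib.Analysis.Complex.ExponentialBounds
import Literature.NumberTheory.LFunctions.AxlerPrimeCountingBounds
import Literature.NumberTheory.LFunctions.RosserSchoenfeldEq321FromDusart
import Literature.IUT.LogVolume.ExplicitEstimatesTheorem51
import Literature.IUT.LogVolume.ExplicitEstimatesPrimeChoice
import HarnessLib

/-!
# [ExpEst] Proposition 2.2 (Effective versions of the prime number theorem) — PROVED from named classical facts

S. Mochizuki, I. Fesenko, Y. Hoshi, A. Minamide, W. Porowski, *Explicit estimates in inter-universal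
Teichmüller theory*, Kodai Math. J. **45** (2022) 175–236 (= [ExpEst]), §2 "Auxiliary numerical results",
**Proposition 2.2**, journal p. 197 (render `plan/repair/lit/renders/MFHMP-ExplicitEstimates-Kodai2022-book-anonnd-eeiutp`,
pdf p. 23 l.11 – p. 24 l.9; pdf page = journal page − 174). The bibliographic key `MochizukiEtAl2022` carries the
D-0012 claim status (its §5 depends on [IUTchIII] Cor. 3.12), hence the tag form on the transcribed statements;
the mathematics of Prop. 2.2 is CLASSICAL and undisputed (explicit Chebyshev / prime-counting estimates), and
every statement below is a THEOREM, proved from NAMED published facts of the tree — no new named fact is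
introduced in this file, nothing is asserted about [IUTchIII] Cor. 3.12.

**Prop. 2.2 as printed (p. 197).** "For `x ∈ ℝ_{≥2}`, write `π(x) := #{p ∈ Primes | p ≤ x}`;
`θ(x) := Σ_{p ∈ Primes, p ≤ x} log(p)`. Set `η_prm := 5·10^20`; `ξ_prm := 10^15`. Then the following hold:
(i) For any real number `x ≥ η_prm`, it holds that `π(x) ≤ 1.022·x/log(x)` [cf. [IUTchIV], Proposition 1.6].
(ii) For any real number `x ≥ ξ_prm`, it holds that `|θ(x) − x| ≤ 0.00071·x`. In particular, if `𝒜` is a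
finite subset of `Primes`, and we write `θ_𝒜 := Σ_{p ∈ 𝒜} log(p)` [where we take the sum to be `0` if
`𝒜 = ∅`], then there exists a prime number `p ∉ 𝒜` such that
`p ≤ (1 − 0.00071)⁻¹·(θ_𝒜 + ξ_prm) ≤ 1.00072·(θ_𝒜 + ξ_prm)` [cf. [IUTchIV], Proposition 2.1, (ii)]."

**Printed proof (p. 197–198) and what is done here.**
* (i): "`log(x) ≥ log(η_prm) ≥ 47.66 ≥ 1.17/0.0246`. Thus `π(x) ≤ x/(log x − 1 − 1.17/log x) ≤ x/(log x − 1.0246)`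
  [cf. [Ax1], Corollary 3.4; [Ax2]]. Therefore `1.022·x/log(x) ≥ x/(log(x) − 1.0246) ≥ π(x)`." — FOLLOWED:
  `ExpEst.prop22i` is proved from the tree's named fact
  `Literature.NumberTheory.LFunctions.Axler2016_cor34_primeCounting_lt` (Axler, Integers 16 (2016) A22,
  Cor. 3.4, last display: "`x ≥ 5.43 ⟹ π(x) < x/(log x − 1 − 1.17/log x)`", file
  `AxlerPrimeCountingBounds.lean`) via its proved consequence `le_mul_div_log` with `c = 1.022`; the kernel
  uses `log(5·10^20) ≥ 47.6` (`ExpEst.log_etaPrm_ge`; print: `47.66`), which suffices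
  (`1.022·(1 + 1.17/47.6) = 1.04712… ≤ 1.0472 = 0.022·47.6`).
* (ii): "`log(x) ≥ log(ξ_prm) ≥ 34.53`. Then since `0.0242269/log(x) ≤ 0.00071`, assertion (ii) follows
  immediately from [RS], Theorem 7" (Rosser–Schoenfeld, Math. Comp. 29 (1975) 243–269, Thm. 7; NOT HELD in
  the literature store). — DEVIATION (Literature already provides the step, D-0026: no new fact where an
  existing one serves): `ExpEst.prop22ii` is proved from the tree's named fact
  `Literature.NumberTheory.LFunctions.Dusart2010_theta_thm_5_2` (P. Dusart, arXiv:1002.0442 (2010) Thm. 5.2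
  = Ramanujan J. 45 (2018): "`|θ(x) − x| < 0.2·x/ln²x` for `x ≥ 3 594 641`", file
  `RosserSchoenfeldEq321FromDusart.lean`): for `x ≥ 10^15` one has `log x ≥ 34` (`ExpEst.log_xiPrm_ge`; print:
  `34.53`) and `0.2/34² = 1.73·10⁻⁴ ≤ 7.1·10⁻⁴`. The "in particular" clause is `ExpEst.prop22ii_particular`
  (via the tree's `ExpEst.exists_prime_not_mem_le_of_theta00071`, and `(1 − 0.00071)⁻¹ = 1.000710… ≤ 1.00072`).

**What this discharges (by name).** The two PRIME-NUMBER-THEOREM INPUTS of the tree's kernel chains for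
[ExpEst] Thm. 5.1 / Cor. 5.2: the field `Thm110Numerics.ProofData51.pnt51` of
`ExplicitEstimatesTheorem51Proof.lean` ("[ExpEst] Prop. 2.2 (i) at `x = e*_mod·l`") is supplied by
`Thm110Numerics.pnt51_of_axler` (for `l ≥ 10^15`, using `e*_mod·l ≥ 5·10^20` =
`Thm110Numerics.estar_mul_l_ge_etaPrm51`), and the binder `hθ` of
`Cor22.PrimeChoiceData.exists_prime_P1_P2_P3_expEst` (`ExplicitEstimatesPrimeChoice.lean`) is supplied by
`Cor22.PrimeChoiceData.exists_prime_P1_P2_P3_expEst_of_dusart` (for data with `ξ_prm ≥ 10^15`). After this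
file those chains rest, on the prime-number side, on exactly two NAMED published facts
(`Axler2016_cor34_primeCounting_lt`, `Dusart2010_theta_thm_5_2`) instead of anonymous binders.

Deliberately NOT here: the constants `η_prm`, `ξ_prm` as new definitions (they appear as the literals
`5 * 10 ^ 20`, `10 ^ 15`, so that no definition is minted); Rosser–Schoenfeld 1975 Thm. 7 as a fact (not
needed; not held); Prop. 2.1 (j-invariants of arithmetic elliptic curves — its four values are the tree's
`Cor22.AdmitsCore` / `coreExceptionalJ` vocabulary, cited by name in `ExplicitEstimatesTheorem51Legendre.lean`).

## References
* [MochizukiEtAl2022] Kodai Math. J. 45 (2022) 175–236, Prop. 2.2 (p. 197) [claim key, D-0012].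
* [Axler2016] C. Axler, Integers 16 (2016) A22, Cor. 3.4 (last display) — the tree's
  `Axler2016_cor34_primeCounting_lt`.
* [Dusart2010] P. Dusart, arXiv:1002.0442, Thm. 5.2 — the tree's `Dusart2010_theta_thm_5_2`.
* J. B. Rosser, L. Schoenfeld, Math. Comp. 29 (1975) 243–269, Thm. 7 (the printed source of (ii); context only).
-/

noncomputable section

namespace Literature.IUT.LogVolume

open Real Finset
open scoped Nat.Prime Chebyshev
open Literature.NumberTheory.LFunctions (Axler2016_cor34_primeCounting_lt Dusart2010_theta_thm_5_2)

namespace ExpEst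

/-- `e ≤ 2.7183` (Mathlib `Real.exp_one_lt_d9`). [folklore] -/
private theorem exp_one_le : Real.exp 1 ≤ 2.7183 := le_of_lt (lt_trans Real.exp_one_lt_d9 (by norm_num))

/-- `log(η_prm) = log(5·10^20) ≥ 47.6` — the kernel's version of the printed "`log(η_prm) ≥ 47.66`"
(p. 197, proof of (i)); certified as `e^48 ≤ 2.7183^48 ≤ 5·10^20·1.44 ≤ 5·10^20·e^{0.4}`.
[claim: MochizukiEtAl2022, status: disputed] -/
theorem log_etaPrm_ge : (47.6 : ℝ) ≤ Real.log (5 * 10 ^ 20) := by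
  rw [Real.le_log_iff_exp_le (by norm_num)]
  have h04 : (1.44 : ℝ) ≤ Real.exp 0.4 := by
    have h := Real.add_one_le_exp (0.2 : ℝ)
    have e : Real.exp 0.4 = Real.exp 0.2 ^ 2 := by
      rw [← Real.exp_nat_mul]; norm_num
    rw [e]; nlinarith [Real.exp_pos (0.2 : ℝ)]
  have h48 : Real.exp 47.6 * Real.exp 0.4 ≤ 5 * 10 ^ 20 * 1.44 := by
    rw [← Real.exp_add]
    have e : (47.6 : ℝ) + 0.4 = (48 : ℕ) * 1 := by norm_num
    rw [e, Real.exp_nat_mul]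
    calc Real.exp 1 ^ 48 ≤ (2.7183 : ℝ) ^ 48 :=
          pow_le_pow_left₀ (Real.exp_pos 1).le exp_one_le 48
      _ ≤ 5 * 10 ^ 20 * 1.44 := by norm_num
  by_contra hlt
  push Not at hlt
  have : 5 * 10 ^ 20 * Real.exp 0.4 < Real.exp 47.6 * Real.exp 0.4 :=
    mul_lt_mul_of_pos_right hlt (Real.exp_pos _)
  nlinarith [Real.exp_pos (0.4 : ℝ)]

/-- **[ExpEst] Proposition 2.2 (i)** (p. 197): "For any real number `x ≥ η_prm` [= `5·10^20`], it holds that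
`π(x) ≤ 1.022·x/log(x)`." PROVED from Axler 2016, Cor. 3.4 (last display), taken by name as the hypothesis
`hAx`, exactly as in the printed proof (`log x ≥ 47.6 ≥ 1.17/0.0246`, so
`x/(log x − 1 − 1.17/log x) ≤ 1.022·x/log x`). `π(x) = Nat.primeCounting ⌊x⌋₊`.
[claim: MochizukiEtAl2022, status: disputed] -/
theorem prop22i (hAx : Axler2016_cor34_primeCounting_lt) {x : ℝ} (hx : (5 * 10 ^ 20 : ℝ) ≤ x) :
    (π ⌊x⌋₊ : ℝ) ≤ 1.022 * x / Real.log x := by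
  have hx0 : (0 : ℝ) < 5 * 10 ^ 20 := by norm_num
  have hL : (47.6 : ℝ) ≤ Real.log x := le_trans log_etaPrm_ge (Real.log_le_log hx0 hx)
  refine hAx.le_mul_div_log (le_trans (by norm_num) hx) (by norm_num) ?_
  -- `1.022·(1 + 1.17/L) ≤ 0.022·L` for `L ≥ 47.6`: `1.022 + 1.19574/47.6 = 1.04712… ≤ 1.0472`
  have h1 : 1.17 / Real.log x ≤ 1.17 / 47.6 := div_le_div_of_nonneg_left (by norm_num) (by norm_num) hL
  linarith

/-- `log(ξ_prm) = log(10^15) ≥ 34` — the kernel's version of the printed "`log(ξ_prm) ≥ 34.53`" (p. 198,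
proof of (ii)); certified as `e^34 ≤ 2.7183^34 ≤ 10^15`. [claim: MochizukiEtAl2022, status: disputed] -/
theorem log_xiPrm_ge : (34 : ℝ) ≤ Real.log (10 ^ 15) := by
  rw [Real.le_log_iff_exp_le (by norm_num)]
  have e : (34 : ℝ) = (34 : ℕ) * 1 := by norm_num
  rw [e, Real.exp_nat_mul]
  calc Real.exp 1 ^ 34 ≤ (2.7183 : ℝ) ^ 34 := pow_le_pow_left₀ (Real.exp_pos 1).le exp_one_le 34
    _ ≤ 10 ^ 15 := by norm_num

/-- **[ExpEst] Proposition 2.2 (ii), first sentence** (p. 197): "For any real number `x ≥ ξ_prm` [= `10^15`],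
it holds that `|θ(x) − x| ≤ 0.00071·x`." PROVED — from the tree's named fact `Dusart2010_theta_thm_5_2`
("`|θ(x) − x| < 0.2·x/ln²x` for `x ≥ 3 594 641`", hypothesis `hD`) and `log x ≥ 34`: `0.2/34² ≤ 0.00071`.
(Printed route: Rosser–Schoenfeld 1975 Thm. 7 with `0.0242269/log x ≤ 0.00071`; see the module docstring.)
`θ = Chebyshev.theta`. [claim: MochizukiEtAl2022, status: disputed] -/
theorem prop22ii (hD : Dusart2010_theta_thm_5_2) {x : ℝ} (hx : (10 ^ 15 : ℝ) ≤ x) :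
    |θ x - x| ≤ 0.00071 * x := by
  have hx0 : 0 < x := lt_of_lt_of_le (by norm_num) hx
  have hL : (34 : ℝ) ≤ Real.log x := le_trans log_xiPrm_ge (Real.log_le_log (by norm_num) hx)
  have h := hD x (le_trans (by norm_num) hx)
  have hL2 : (34 : ℝ) ^ 2 ≤ Real.log x ^ 2 := pow_le_pow_left₀ (by norm_num) hL 2
  have hq : 0.2 * x / Real.log x ^ 2 ≤ 0.00071 * x := by
    rw [div_le_iff₀ (by positivity)]
    nlinarith
  exact le_trans h.le hq

/-- **[ExpEst] Proposition 2.2 (ii), "in particular"** (p. 197): "if `𝒜` is a finite subset of `Primes`, and we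
write `θ_𝒜 := Σ_{p ∈ 𝒜} log(p)` …, then there exists a prime number `p ∉ 𝒜` such that
`p ≤ (1 − 0.00071)⁻¹·(θ_𝒜 + ξ_prm) ≤ 1.00072·(θ_𝒜 + ξ_prm)`." PROVED (from `prop22ii` via the tree's
`ExpEst.exists_prime_not_mem_le_of_theta00071`; `θ_𝒜` is the tree's `thetaSet 𝒜`, and as there `𝒜` may be
any finite set of naturals). [claim: MochizukiEtAl2022, status: disputed] -/
theorem prop22ii_particular (hD : Dusart2010_theta_thm_5_2) (A : Finset ℕ) :
    ∃ p : ℕ, p.Prime ∧ p ∉ A ∧ (p : ℝ) ≤ (thetaSet A + 10 ^ 15) / (1 - 0.00071) ∧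
      (p : ℝ) ≤ 1.00072 * (thetaSet A + 10 ^ 15) := by
  obtain ⟨p, hp, hpA, hle⟩ :=
    exists_prime_not_mem_le_of_theta00071 (ξ := (10 : ℝ) ^ 15) (by norm_num)
      (fun _ hx => prop22ii hD hx) A
  refine ⟨p, hp, hpA, hle, le_trans hle ?_⟩
  have h0 : 0 ≤ thetaSet A + 10 ^ 15 := by
    have : 0 ≤ thetaSet A := Finset.sum_nonneg fun q _ => Real.log_natCast_nonneg q
    positivity
  rw [div_le_iff₀ (by norm_num)]
  nlinarith

end ExpEst

/-! ### The two discharges (bridges to the Thm 5.1 and Cor 5.2 chains) -/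

/-- **`ProofData51.pnt51` discharged**: for [IUTchIV]/[ExpEst] numerics `X` with `l ≥ 10^15`,
`π(e*_mod·l) ≤ 1.022·(e*_mod·l)/log(e*_mod·l)` — [ExpEst] Prop. 2.2 (i) at `x = e*_mod·l ≥ 5·10^20`
(`Thm110Numerics.estar_mul_l_ge_etaPrm51`, p36.l20–22), from Axler's fact by name. This is literally the type
of the INPUT field `Thm110Numerics.ProofData51.pnt51` (`ExplicitEstimatesTheorem51Proof.lean`).
[claim: MochizukiEtAl2022, status: disputed] -/
theorem Thm110Numerics.pnt51_of_axler (hAx : Axler2016_cor34_primeCounting_lt) {X : Thm110Numerics}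
    (hL : 10 ^ 15 ≤ X.l) :
    (π (X.estar * X.l) : ℝ) ≤ 1.022 * ((X.estar : ℝ) * X.l) / Real.log ((X.estar : ℝ) * X.l) := by
  have h := ExpEst.prop22i hAx (x := ((X.estar * X.l : ℕ) : ℝ))
    (by exact_mod_cast X.estar_mul_l_ge_etaPrm51 hL)
  rw [Nat.floor_natCast] at h
  exact_mod_cast h

/-- **The `hθ` binder of `exists_prime_P1_P2_P3_expEst` discharged**: for prime-choice data `A`
(`Cor22.PrimeChoiceData`) whose `ξ_prm` is at least [ExpEst]'s `10^15`, with `δ ≥ 552960` and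
`h^{1/2} ≥ 10^15`, the (P1)–(P3) prime of [ExpEst] Cor. 5.2 (p. 213–214) EXISTS, from Dusart's fact by name
(the bound `|θ(x) − x| ≤ 0.00071·x` holds for every `x ≥ 10^15`, hence for every `x ≥ A.ξ`).
[claim: MochizukiEtAl2022, status: disputed] -/
theorem Cor22.PrimeChoiceData.exists_prime_P1_P2_P3_expEst_of_dusart (hD : Dusart2010_theta_thm_5_2)
    (A : Cor22.PrimeChoiceData) (hξ : (10 : ℝ) ^ 15 ≤ A.ξ)
    (hδ : (552960 : ℝ) ≤ A.δ) (hlarge : (10 : ℝ) ^ 15 ≤ Real.sqrt A.h) :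
    ∃ l : ℕ, l.Prime ∧ Real.sqrt A.h ≤ l ∧
      (l : ℝ) ≤ 1.464 * A.δ * Real.sqrt A.h * Real.log (1.45 * A.δ * A.h) ∧
      (∀ v ∈ A.V, A.hv v ≠ 0 → ¬ l ∣ A.hv v) ∧
      (∀ v ∈ A.V, A.pv v = l → (A.hv v : ℝ) < Real.sqrt A.h) :=
  A.exists_prime_P1_P2_P3_expEst (fun _ hx => ExpEst.prop22ii hD (le_trans hξ hx)) hδ hlarge

end Literature.IUT.LogVolume

end
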